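import Literature.MathematicalPhysics.QuantumFieldTheory.Balaban1983to89.B9Eq325RLipschitzClosed
import Literature.MathematicalPhysics.QuantumFieldTheory.Balaban1983to89.B9Eq325RLipschitzSqrt
import Literature.MathematicalPhysics.QuantumFieldTheory.Balaban1983to89.B9Eq365QGGQLowerVariationalSharp

/-!
# `Balaban1983to89.B9Eq325RLipschitzClosedSqrt` — T. Bałaban, *Propagators for lattice gauge theories in a background field*, Commun. Math.
# Phys. **99** (1985) 389–434 [Balaban1985BackgroundPropagators] p. 403 with (3.25) p. 394, (3.35) p. 396: **THE `κ^{−1∕2}` ROAD CLOSED —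
# `‖R(U)f − R(1)f‖ ≤ δ_A(1∕(s − δ_A) + 1∕s)·‖f‖`, `δ_A = θ_G M_Q + γ⁻¹θ_Q`, `s = √κ₀`, WITH ne9-leaf-06's S3d LETTERS DISCHARGED, AND ON BAŁABAN's
# DIAGONAL WITH THE SHARP FLAT FLOOR `s♯ = (12d(6∕5)^{d−1} + a′)⁻¹` EVERY LETTER A FUNCTION OF `(d, a′, K, α)`** — the closure twin of
# `B9Eq325RLipschitzClosed` (v1.2) with NE9 leaf-01's `B9Eq325RLipschitzSqrt.norm_RofU_sub_RofU_le_sqrt` in place of S3d's `norm_RofU_sub_RofU_le`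
# (route R2′ STEP B7′ S3, pub-balaban NE9 chain)

statement-level skeleton of published theorems with citation tags; proofs where landed; nothing here is a claim about the Yang–Mills mass gap

CITATION HEADER (lean-in-tree rule).  Audit cell `pub-balaban`, sub-cell `t4`, BINDER row NE9; filed by NE9 formalisation-swarm LEAF PROVER 01
(`b2b-balaban-t4-ne9-formalise-leaf-01`, gen 79) as the closure of its `B9Eq325RLipschitzSqrt` (INTENT-2, journal l.47147; route author
t4-ne9-idea-1 g88 «GO, THIS SHAPE» l.47186), offered first to ne9-leaf-06 (S3d author).  THE LETTER DERIVATIONS `(γ at U)`, `(γ at 1)`, `(M_Q, θ_Q)`,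
`(δ_D)`, `(θ_G)` ARE ne9-leaf-06 g64's (`B9Eq325RLipschitzClosed.norm_RofU_sub_RofU_one_le_of_letters` v1.2, p341255), COPIED WITH CREDIT letter for
letter; new here: `g = γ⁻¹` (`B9Eq3126GreenLetters.norm_greenK_le`) and the last line.  Source READ in the held text layer
(`paper:balaban1985-cmp99-background-propagators`): p. 403 *«the operators R(U), P(U) = I − R(U) … satisfy the same bounds»*, (3.25), (3.35).

WHAT IS PROVED (sorry-free; 0 `def`; axioms standard; composition BY NAME; nothing of [B9] asserted as printed).
* §1 **`norm_RofU_sub_RofU_one_le_sqrt_of_letters`** — VERBATIM the hypotheses of ne9-leaf-06's `norm_RofU_sub_RofU_one_le_of_letters` v1.2 (`hRS`,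
  `εR`, `η ≠ 0`, `0 < ηL ≤ 1`, `c₁(ηL)² = c₀L^d`, `0 < a′`; `t ≥ ‖η⁻¹‖εR`, `ρ ≥ (1+εR)^{d(L−1)} − 1`, the flat minorant `κ₀` IN FORM `hκ1`; `γ, M_Q, θ_Q, θ_G`
  by the same definitional equalities; `0 < γ`) MINUS `δ_K`, `κ = κ₀ − δ_K`, `0 < κ`, PLUS `0 < κ₀` and the window `θ_G M_Q + γ⁻¹θ_Q < √κ₀`:
  `‖R(U)f − R(1)f‖ ≤ ((θ_GM_Q + γ⁻¹θ_Q)∕(√κ₀ − (θ_GM_Q + γ⁻¹θ_Q)) + (θ_GM_Q + γ⁻¹θ_Q)∕√κ₀)·‖f‖`.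
* §2 `div_sub_add_div_le_three` (`δ∕(s−δ) + δ∕s ≤ 3δ∕s` on `2δ ≤ s` — the α-linear∕anchored shape, t4-ne9-idea-1 g88).
* §3 **`norm_RofU_sub_RofU_one_le_sqrt_diagonal_of_slot`** — at `ηL = 1`, `c₀L^d = c₁`, `‖R_b w − w‖ ≤ Kαη‖w‖`: `t = Kα`, `ρ = e^{dKα} − 1`, `s = 1`,
  `κ₀ > 0` ANY flat minorant IN FORM (`hκ1`, ne9-leaf-06 g64's located ask W-3 l.47371 — a Bloch-exact `κ(1)` drops in without a new version);
  **`norm_RofU_sub_RofU_one_le_sqrt_diagonal`** — the slot fed by `B9Eq365QGGQLowerVariationalSharp.qggq_coercive_sharp_one_diagonal`: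
  `√κ₀ = s♯ = (12d(6∕5)^{d−1} + a′)⁻¹`, window `0 < γ`, `θ_GM_Q + γ⁻¹θ_Q < s♯` — every letter a function of `(d, a′, K, α)`, NO `3 ≤ L`, NO `κ⁻²`;
  **`norm_RofU_sub_RofU_one_le_sqrt_diagonal_linear`** — on `2(θ_GM_Q + γ⁻¹θ_Q) ≤ s♯`: `‖R(U)f − R(1)f‖ ≤ (3(θ_GM_Q + γ⁻¹θ_Q)∕s♯)‖f‖`.
NUMBERS (floats on the displayed closed forms, d = 4, a′ = 1, K = 2, orientation only): `s♯ = 1∕83.94 = 1.19·10⁻²`, `γ ≈ 0.25`, `M_Q ≈ 1 + 8α`,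
`θ_Q ≈ 8α`, `θ_G ≈ 320α` ⇒ `δ_A ≈ 352α`; window `α ≲ 3.4·10⁻⁵` (v1.2 Closed: `≈ 5·10⁻⁸`); `‖R(U) − R(1)‖ ≲ 6·10⁴·α` for `α ≪ 10⁻⁵` (v1.2: `≈ 2·10¹²·α`).
HONEST SCOPE.  A closure by composition; the window is still `α`-small and `d`-dependent through `s♯`; no optimality claimed; NOT NE9, NOT the route
(cell pub-balaban: NE9 NOT PRINTED ∕ NOT PROVED; «NE9 ⇐ the named binders»; row WALLED ON A MODEL (O-NE9-1; #5 UNRULED); spine PROVED 0∕9; rung (B)+1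
on a finite T⁴ — NOT infinite volume, NOT mass gap, NOT Clay; HONEST DEPENDENCY: continuum YM on T⁴ ⇐ BetaPertH ∧ nine spine estimates (0/9 proved);
BetaPertH ⇐ (D1) ∧ (D4) ∧ CAP+tail; G-an2-4 gates asym, D1 and NE2/3/4).  NEW file importing `B9Eq325RLipschitzClosed` (ne9-leaf-06),
`B9Eq325RLipschitzSqrt` and `B9Eq365QGGQLowerVariationalSharp` (this lineage); nothing modified.  Net new unproved facts: 0.
-/

noncomputable section

open scoped InnerProductSpace ComplexConjugate BigOperators

namespace Literature.MathematicalPhysics.QuantumFieldTheory.Balaban1983to89.B9Eq325RLipschitzClosedSqrt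

open B4Sect5Torus (TSite)
open B9SectCLatticeCarrier (Bond)
open B9Eq311L2Pairing (WL2)
open B9Eq319QprimeTorus (fineP)
open B11Eq103H1Complex (SiteL2K greenK covDerivL2K)
open B9Eq310HessianOperator (adTransportW)
open B5Eq172HodgePositivity (adTransportW_one hRS_one)
open B9Eq326OperatorAssembly (QprimeW RofU)
open B9Eq3119DeltaPiCarrier (laplacePrimeA GpOfU)
open B9Thm311DeltaPrimeA (laplacePrimeA_one_pos)
open B9Eq373DerivativeRemainderL2 (norm_covDerivL2K_sub_le)
open B9Eq319QprimeLipschitz (rho_nonneg)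
open B9Eq364GreenLipschitzForm (norm_GpOfU_sub_GpOfU_le)
open B9Thm311SitePrimeFormCoercive (flat_site_strong_coercive)
open B9Thm311SitePrimeFormCoerciveCanonical (strong_site_coercive_canonical norm_Qtilde_sub_flat_le norm_Qtilde_flat_le)
open B9Eq3126GreenLetters (norm_greenK_le)
open B9Eq325RLipschitzClosed (pos_of_coercive rho_le_exp_sub_one)
open B9Eq325RLipschitzSqrt (norm_RofU_sub_RofU_le_sqrt)
open B9Eq365QGGQLowerVariationalSharp (qggq_coercive_sharp_one_diagonal)

/-! ## §1 The closure at `(U, 1)` by the `κ^{−1∕2}` road: leaf-06's letters `t, ρ, κ₀, γ, M_Q, θ_Q, θ_G`, NO `δ_K`, NO `κ⁻¹` -/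

section Letters

variable {d : ℕ} (L : ℕ) [NeZero L] (m : Fin d → ℕ)
  {𝔸 : Type*} [Ring 𝔸] [Algebra ℂ 𝔸]
  {W : Type*} [NormedAddCommGroup W] [InnerProductSpace ℂ W] [FiniteDimensional ℂ W] (φ : W ≃ₗ[ℂ] 𝔸)
  (c₀ : ℝ) [Fact (0 < c₀)] (η : ℝ) (c₁ : ℝ) [Fact (0 < c₁)] {a' : ℝ} (ha' : 0 < a')
  (U : Bond d (fineP L m) → 𝔸ˣ)
  (hRS : ∀ (b : Bond d (fineP L m)) (v u : W), ⟪adTransportW φ U b v, u⟫_ℂ = ⟪v, adTransportW φ (fun b => (U b)⁻¹) b u⟫_ℂ)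
  {εR : ℝ} (hεR : 0 ≤ εR) (hRε : ∀ (b : Bond d (fineP L m)) (w : W), ‖adTransportW φ U b w - w‖ ≤ εR * ‖w‖)

include ha' hRS hεR hRε

/-- **`‖R(U)f − R(1)f‖ ≤ δ_A(1∕(√κ₀ − δ_A) + 1∕√κ₀)·‖f‖, `δ_A = θ_G M_Q + γ⁻¹θ_Q`, WITH ne9-leaf-06's LETTERS DISCHARGED** — VERBATIM the hypotheses of
`B9Eq325RLipschitzClosed.norm_RofU_sub_RofU_one_le_of_letters` v1.2 (`hRS`, `εR`, `η ≠ 0`, `0 < ηL ≤ 1`, `c₁(ηL)² = c₀L^d`, `0 < a′`; the primitive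
letters `t ≥ ‖η⁻¹‖εR`, `ρ ≥ (1+εR)^{d(L−1)} − 1`, the flat minorant `κ₀` IN FORM `hκ1`; `γ, M_Q, θ_Q, θ_G` by the same definitional equalities)
MINUS `δ_K`, `κ = κ₀ − δ_K` and the window `0 < κ`, PLUS `0 < κ₀` and the window `θ_G M_Q + γ⁻¹θ_Q < √κ₀`; conclusion by NE9 leaf-01's
`B9Eq325RLipschitzSqrt.norm_RofU_sub_RofU_le_sqrt` in place of S3d's `norm_RofU_sub_RofU_le` (the letters `(γ at U)`, `(γ at 1)`, `(M_Q, θ_Q)`,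
`(δ_D)`, `(θ_G)` are ne9-leaf-06 g64's derivations, copied with credit; `g = γ⁻¹` by `B9Eq3126GreenLetters.norm_greenK_le`). [cite: Balaban1985BackgroundPropagators, p.403, (3.25) p.394, (3.63)–(3.68) pp.402–403, Thm 3.11 p.416] -/
theorem norm_RofU_sub_RofU_one_le_sqrt_of_letters (hη : η ≠ 0) (hηL0 : 0 < η * L) (hηL1 : η * L ≤ 1)
    (hs : c₁ * (η * L) ^ 2 = c₀ * (L : ℝ) ^ d) {t ρ κ₀ γ MQ θQ θG : ℝ} (hκ₀ : 0 < κ₀)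
    (ht : ‖((η : ℂ))⁻¹‖ * εR ≤ t) (hρ : (1 + εR) ^ (d * (L - 1)) - 1 ≤ ρ)
    (hκ1 : ∀ ψ : SiteL2K ℂ d m c₁ W, κ₀ * ‖ψ‖ ^ 2 ≤ RCLike.re ⟪ψ,
      (((WL2.linearEquiv ℂ ℂ (fun _ : TSite d m => c₁)).symm.toLinearMap ∘ₗ
          QprimeW L m φ (fun _ : Bond d (fineP L m) => (1 : 𝔸ˣ)) (c₀ := c₀)) ∘ₗ
        GpOfU L m φ η (fun _ : Bond d (fineP L m) => (1 : 𝔸ˣ)) a' (c₁ := c₁) (laplacePrimeA_one_pos L m φ η a' hη ha') ∘ₗ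
        GpOfU L m φ η (fun _ : Bond d (fineP L m) => (1 : 𝔸ˣ)) a' (c₁ := c₁) (laplacePrimeA_one_pos L m φ η a' hη ha') ∘ₗ
        LinearMap.adjoint ((WL2.linearEquiv ℂ ℂ (fun _ : TSite d m => c₁)).symm.toLinearMap ∘ₗ
          QprimeW L m φ (fun _ : Bond d (fineP L m) => (1 : 𝔸ˣ)) (c₀ := c₀))) ψ⟫_ℂ)
    (hγdef : γ = (1 / (2 + 2 / a') - (Real.sqrt d * t + (Real.sqrt d * t) ^ 2 +
      a' * (ρ * (η * L)⁻¹) * (2 * (η * L)⁻¹ + ρ * (η * L)⁻¹))) * ((η * L)⁻¹) ^ 2)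
    (hMQdef : MQ = (1 + ρ) * (η * L)⁻¹) (hθQdef : θQ = ρ * (η * L)⁻¹)
    (hθGdef : θG = 2 * (Real.sqrt d * t) * (γ⁻¹ * (Real.sqrt γ)⁻¹) + (|a'| * θQ * (MQ + MQ)) * γ⁻¹ ^ 2)
    (hγ : 0 < γ) (hwin : θG * MQ + γ⁻¹ * θQ < Real.sqrt κ₀)
    (f : SiteL2K ℂ d (fineP L m) c₀ W) :
    ‖RofU L m φ η U (c₀ := c₀) f - RofU L m φ η (fun _ : Bond d (fineP L m) => (1 : 𝔸ˣ)) (c₀ := c₀) f‖ ≤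
      ((θG * MQ + γ⁻¹ * θQ) / (Real.sqrt κ₀ - (θG * MQ + γ⁻¹ * θQ)) + (θG * MQ + γ⁻¹ * θQ) / Real.sqrt κ₀) * ‖f‖ := by
  have hc₀ : 0 < c₀ := Fact.out
  have hc₁ : 0 < c₁ := Fact.out
  have hLr : (0 : ℝ) < L := by exact_mod_cast Nat.pos_of_ne_zero (NeZero.ne L)
  have hη0 : 0 < η := pos_of_mul_pos_left hηL0 hLr.le
  -- the scale letter `s = (ηL)⁻¹ ≥ 1` and the weight factor `√(c₁/(c₀L^d)) = s`
  have hs0 : 0 < (η * L)⁻¹ := by positivity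
  have hs1 : (1 : ℝ) ≤ (η * L)⁻¹ := one_le_inv_iff₀.mpr ⟨hηL0, hηL1⟩
  have hratio : Real.sqrt (c₁ / (c₀ * (L : ℝ) ^ d)) = (η * L)⁻¹ := by
    have h1 : c₁ / (c₀ * (L : ℝ) ^ d) = ((η * L)⁻¹) ^ 2 := by
      rw [← hs]; field_simp
    rw [h1, Real.sqrt_sq hs0.le]
  have ht0' : 0 ≤ ‖((η : ℂ))⁻¹‖ * εR := mul_nonneg (norm_nonneg _) hεR
  have ht0 : 0 ≤ t := ht0'.trans ht
  have hρ'0 : 0 ≤ (1 + εR) ^ (d * (L - 1)) - 1 := rho_nonneg L (d := d) hεR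
  have hρ0 : 0 ≤ ρ := hρ'0.trans hρ
  have hd0 : (0 : ℝ) ≤ Real.sqrt d := Real.sqrt_nonneg _
  -- the primitive and the route letters are nonnegative
  have hMQ0 : 0 ≤ MQ := by rw [hMQdef]; positivity
  have hθQ0 : 0 ≤ θQ := by rw [hθQdef]; positivity
  have hθG0 : 0 ≤ θG := by rw [hθGdef]; positivity
  have hR₁ : ∀ (b : Bond d (fineP L m)) (w : W), adTransportW φ (fun _ : Bond d (fineP L m) => (1 : 𝔸ˣ)) b w = w := fun b w => by
    rw [adTransportW_one]; rfl
  have hpos₂ : ∀ x : SiteL2K ℂ d (fineP L m) c₀ W, x ≠ 0 →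
      0 < RCLike.re ⟪x, laplacePrimeA L m φ η (fun _ : Bond d (fineP L m) => (1 : 𝔸ˣ)) a' (c₁ := c₁) x⟫_ℂ :=
    laplacePrimeA_one_pos L m φ η a' hη ha'
  -- (γ at U) leaf-03's strong site coercivity, the derivative row dropped, the defect majorised by `(t, ρ)`
  have hcU : ∀ x : SiteL2K ℂ d (fineP L m) c₀ W, γ * ‖x‖ ^ 2 ≤ RCLike.re ⟪x, laplacePrimeA L m φ η U a' (c₁ := c₁) x⟫_ℂ := by
    intro x
    have h := strong_site_coercive_canonical L m φ (c₀ := c₀) (c₁ := c₁) U ha' hRS hεR hRε hηL0 hηL1 hs x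
    set θ' : ℝ := Real.sqrt d * (‖((η : ℂ))⁻¹‖ * εR) + (Real.sqrt d * (‖((η : ℂ))⁻¹‖ * εR)) ^ 2 +
      a' * (((1 + εR) ^ (d * (L - 1)) - 1) * (η * L)⁻¹) * (2 * (η * L)⁻¹ + ((1 + εR) ^ (d * (L - 1)) - 1) * (η * L)⁻¹) with hθ'
    set θb : ℝ := Real.sqrt d * t + (Real.sqrt d * t) ^ 2 + a' * (ρ * (η * L)⁻¹) * (2 * (η * L)⁻¹ + ρ * (η * L)⁻¹) with hθb
    set D : ℝ := ‖covDerivL2K ℂ c₀ ((η : ℂ))⁻¹ (adTransportW φ (fun _ : Bond d (fineP L m) => (1 : 𝔸ˣ))) x‖ ^ 2 with hD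
    have hD0 : 0 ≤ D := by rw [hD]; positivity
    -- `θ′ ≤ θb` (monotone in the two primitive letters)
    have hmono : θ' ≤ θb := by
      rw [hθ', hθb]
      have h1 : Real.sqrt d * (‖((η : ℂ))⁻¹‖ * εR) ≤ Real.sqrt d * t := mul_le_mul_of_nonneg_left ht hd0
      have h2 : (Real.sqrt d * (‖((η : ℂ))⁻¹‖ * εR)) ^ 2 ≤ (Real.sqrt d * t) ^ 2 :=
        pow_le_pow_left₀ (mul_nonneg hd0 ht0') h1 2
      have h3 : ((1 + εR) ^ (d * (L - 1)) - 1) * (η * L)⁻¹ ≤ ρ * (η * L)⁻¹ := mul_le_mul_of_nonneg_right hρ hs0.le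
      have h4 : 2 * (η * L)⁻¹ + ((1 + εR) ^ (d * (L - 1)) - 1) * (η * L)⁻¹ ≤ 2 * (η * L)⁻¹ + ρ * (η * L)⁻¹ := by linarith
      have h5 : a' * (((1 + εR) ^ (d * (L - 1)) - 1) * (η * L)⁻¹) * (2 * (η * L)⁻¹ + ((1 + εR) ^ (d * (L - 1)) - 1) * (η * L)⁻¹) ≤
          a' * (ρ * (η * L)⁻¹) * (2 * (η * L)⁻¹ + ρ * (η * L)⁻¹) :=
        mul_le_mul (mul_le_mul_of_nonneg_left h3 ha'.le) h4 (by positivity) (by positivity)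
      linarith
    -- the coefficient `1/(2+2/a′) − θb = γ·s⁻² > 0`
    have hcoef : γ = (1 / (2 + 2 / a') - θb) * ((η * L)⁻¹) ^ 2 := by rw [hγdef]
    have hcb : 0 < 1 / (2 + 2 / a') - θb := by
      have : 0 < (1 / (2 + 2 / a') - θb) * ((η * L)⁻¹) ^ 2 := by rw [← hcoef]; exact hγ
      exact pos_of_mul_pos_left this (by positivity)
    have h' : (1 / (2 + 2 / a') - θ') * (D + ((η * L)⁻¹) ^ 2 * ‖x‖ ^ 2) ≤ RCLike.re ⟪x, laplacePrimeA L m φ η U a' (c₁ := c₁) x⟫_ℂ := by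
      rw [hθ', hD]; exact h
    calc γ * ‖x‖ ^ 2 = (1 / (2 + 2 / a') - θb) * (((η * L)⁻¹) ^ 2 * ‖x‖ ^ 2) := by rw [hcoef]; ring
      _ ≤ (1 / (2 + 2 / a') - θb) * (D + ((η * L)⁻¹) ^ 2 * ‖x‖ ^ 2) :=
          mul_le_mul_of_nonneg_left (le_add_of_nonneg_left hD0) hcb.le
      _ ≤ (1 / (2 + 2 / a') - θ') * (D + ((η * L)⁻¹) ^ 2 * ‖x‖ ^ 2) :=
          mul_le_mul_of_nonneg_right (by linarith) (add_nonneg hD0 (by positivity))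
      _ ≤ _ := h'
  have hpos₁ : ∀ x : SiteL2K ℂ d (fineP L m) c₀ W, x ≠ 0 → 0 < RCLike.re ⟪x, laplacePrimeA L m φ η U a' (c₁ := c₁) x⟫_ℂ :=
    pos_of_coercive hγ hcU
  -- (γ at 1) the flat strong form is at least `γ`
  have hc1 : ∀ x : SiteL2K ℂ d (fineP L m) c₀ W, γ * ‖x‖ ^ 2 ≤
      RCLike.re ⟪x, laplacePrimeA L m φ η (fun _ : Bond d (fineP L m) => (1 : 𝔸ˣ)) a' (c₁ := c₁) x⟫_ℂ := by
    intro x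
    have h := flat_site_strong_coercive L m φ (c₀ := c₀) (c₁ := c₁) hη ha' hηL0 hs x
    set D : ℝ := ‖covDerivL2K ℂ c₀ ((η : ℂ))⁻¹ (adTransportW φ (fun _ : Bond d (fineP L m) => (1 : 𝔸ˣ))) x‖ ^ 2 with hD
    have hD0 : 0 ≤ D := by rw [hD]; positivity
    have hγle : γ ≤ 1 / (2 + 2 / a') * ((η * L)⁻¹) ^ 2 := by
      rw [hγdef]
      have hθb0 : 0 ≤ Real.sqrt d * t + (Real.sqrt d * t) ^ 2 + a' * (ρ * (η * L)⁻¹) * (2 * (η * L)⁻¹ + ρ * (η * L)⁻¹) := by positivity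
      have hp := mul_nonneg hθb0 (sq_nonneg ((η * L)⁻¹))
      linarith
    have ha2 : 0 ≤ 1 / (2 + 2 / a') := by positivity
    calc γ * ‖x‖ ^ 2 ≤ 1 / (2 + 2 / a') * ((η * L)⁻¹) ^ 2 * ‖x‖ ^ 2 := mul_le_mul_of_nonneg_right hγle (sq_nonneg _)
      _ ≤ 1 / (2 + 2 / a') * (D + ((η * L)⁻¹) ^ 2 * ‖x‖ ^ 2) := by linarith [mul_nonneg ha2 hD0]
      _ ≤ _ := h
  -- (M_Q, θ_Q) leaf-03's `Q̃′`-letters in the `c₁`-currency, read through `√(c₁/(c₀L^d)) = s`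
  have hq1 : ∀ x : SiteL2K ℂ d (fineP L m) c₀ W, ‖((WL2.linearEquiv ℂ ℂ (fun _ : TSite d m => c₁)).symm.toLinearMap ∘ₗ
      QprimeW L m φ (fun _ : Bond d (fineP L m) => (1 : 𝔸ˣ)) (c₀ := c₀)) x‖ ≤ MQ * ‖x‖ := by
    intro x
    have h := norm_Qtilde_flat_le L m φ (c₀ := c₀) (c₁ := c₁) (𝔸 := 𝔸) x
    rw [hratio] at h
    refine h.trans (mul_le_mul_of_nonneg_right ?_ (norm_nonneg _))
    rw [hMQdef]; exact le_mul_of_one_le_left hs0.le (by linarith)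
  have hdq : ∀ x : SiteL2K ℂ d (fineP L m) c₀ W, ‖((WL2.linearEquiv ℂ ℂ (fun _ : TSite d m => c₁)).symm.toLinearMap ∘ₗ QprimeW L m φ U (c₀ := c₀)) x -
      ((WL2.linearEquiv ℂ ℂ (fun _ : TSite d m => c₁)).symm.toLinearMap ∘ₗ QprimeW L m φ (fun _ : Bond d (fineP L m) => (1 : 𝔸ˣ)) (c₀ := c₀)) x‖ ≤
      θQ * ‖x‖ := by
    intro x
    have h := norm_Qtilde_sub_flat_le L m φ (c₀ := c₀) (c₁ := c₁) U hεR hRε x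
    rw [hratio] at h
    refine h.trans (mul_le_mul_of_nonneg_right ?_ (norm_nonneg _))
    rw [hθQdef]; exact mul_le_mul_of_nonneg_right hρ hs0.le
  have hdq' : ∀ x : SiteL2K ℂ d (fineP L m) c₀ W,
      ‖((WL2.linearEquiv ℂ ℂ (fun _ : TSite d m => c₁)).symm.toLinearMap ∘ₗ QprimeW L m φ (fun _ : Bond d (fineP L m) => (1 : 𝔸ˣ)) (c₀ := c₀)) x -
      ((WL2.linearEquiv ℂ ℂ (fun _ : TSite d m => c₁)).symm.toLinearMap ∘ₗ QprimeW L m φ U (c₀ := c₀)) x‖ ≤ θQ * ‖x‖ := fun x => by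
    rw [norm_sub_rev]; exact hdq x
  have hqU : ∀ x : SiteL2K ℂ d (fineP L m) c₀ W, ‖((WL2.linearEquiv ℂ ℂ (fun _ : TSite d m => c₁)).symm.toLinearMap ∘ₗ
      QprimeW L m φ U (c₀ := c₀)) x‖ ≤ MQ * ‖x‖ := by
    intro x
    have h1 := norm_Qtilde_flat_le L m φ (c₀ := c₀) (c₁ := c₁) (𝔸 := 𝔸) x
    have h2 := norm_Qtilde_sub_flat_le L m φ (c₀ := c₀) (c₁ := c₁) U hεR hRε x
    rw [hratio] at h1 h2
    have h3 := norm_le_norm_add_norm_sub'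
      (((WL2.linearEquiv ℂ ℂ (fun _ : TSite d m => c₁)).symm.toLinearMap ∘ₗ QprimeW L m φ U (c₀ := c₀)) x)
      (((WL2.linearEquiv ℂ ℂ (fun _ : TSite d m => c₁)).symm.toLinearMap ∘ₗ QprimeW L m φ (fun _ : Bond d (fineP L m) => (1 : 𝔸ˣ)) (c₀ := c₀)) x)
    have h4 : ((1 + εR) ^ (d * (L - 1)) - 1) * (η * L)⁻¹ * ‖x‖ ≤ ρ * (η * L)⁻¹ * ‖x‖ :=
      mul_le_mul_of_nonneg_right (mul_le_mul_of_nonneg_right hρ hs0.le) (norm_nonneg _)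
    rw [hMQdef]
    set A := ‖((WL2.linearEquiv ℂ ℂ (fun _ : TSite d m => c₁)).symm.toLinearMap ∘ₗ QprimeW L m φ U (c₀ := c₀)) x‖ with hA
    set B := ‖((WL2.linearEquiv ℂ ℂ (fun _ : TSite d m => c₁)).symm.toLinearMap ∘ₗ
      QprimeW L m φ (fun _ : Bond d (fineP L m) => (1 : 𝔸ˣ)) (c₀ := c₀)) x‖ with hB
    set C := ‖((WL2.linearEquiv ℂ ℂ (fun _ : TSite d m => c₁)).symm.toLinearMap ∘ₗ QprimeW L m φ U (c₀ := c₀)) x -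
      ((WL2.linearEquiv ℂ ℂ (fun _ : TSite d m => c₁)).symm.toLinearMap ∘ₗ QprimeW L m φ (fun _ : Bond d (fineP L m) => (1 : 𝔸ˣ)) (c₀ := c₀)) x‖
      with hC
    have e : (1 + ρ) * (η * L)⁻¹ * ‖x‖ = (η * L)⁻¹ * ‖x‖ + ρ * (η * L)⁻¹ * ‖x‖ := by ring
    rw [e]
    linarith
  -- (δ_D) the derivative remainder `‖D_U x − D_1 x‖ ≤ √d·t·‖x‖`
  have hD : ∀ x : SiteL2K ℂ d (fineP L m) c₀ W, ‖covDerivL2K ℂ c₀ ((η : ℂ))⁻¹ (adTransportW φ U) x -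
      covDerivL2K ℂ c₀ ((η : ℂ))⁻¹ (adTransportW φ (fun _ : Bond d (fineP L m) => (1 : 𝔸ˣ))) x‖ ≤ Real.sqrt d * t * ‖x‖ := by
    intro x
    refine (norm_covDerivL2K_sub_le _ hεR hRε hR₁ x).trans ?_
    have : ‖((η : ℂ))⁻¹‖ * εR * Real.sqrt d ≤ Real.sqrt d * t := by
      rw [mul_comm]; exact mul_le_mul_of_nonneg_left ht hd0
    exact mul_le_mul_of_nonneg_right this (norm_nonneg _)
  have hD' : ∀ x : SiteL2K ℂ d (fineP L m) c₀ W, ‖covDerivL2K ℂ c₀ ((η : ℂ))⁻¹ (adTransportW φ (fun _ : Bond d (fineP L m) => (1 : 𝔸ˣ))) x -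
      covDerivL2K ℂ c₀ ((η : ℂ))⁻¹ (adTransportW φ U) x‖ ≤ Real.sqrt d * t * ‖x‖ := fun x => by
    rw [norm_sub_rev]; exact hD x
  -- (θ_G) the form-relative resolvent step of `B9Eq364GreenLipschitzForm` at `(U, 1)`
  have hG : ∀ y : SiteL2K ℂ d (fineP L m) c₀ W, ‖GpOfU L m φ η U a' (c₁ := c₁) hpos₁ y -
      GpOfU L m φ η (fun _ : Bond d (fineP L m) => (1 : 𝔸ˣ)) a' (c₁ := c₁) hpos₂ y‖ ≤ θG * ‖y‖ := by
    intro y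
    rw [hθGdef]
    exact norm_GpOfU_sub_GpOfU_le L m φ c₀ η U (fun _ : Bond d (fineP L m) => (1 : 𝔸ˣ)) c₁ a' ha'.le hRS (hRS_one φ) hpos₁ hpos₂
      hγ (by positivity) hMQ0 hMQ0 hθQ0 hcU hc1 hD' hqU hq1 hdq' y
  -- (g) `‖G′(1)y‖ ≤ γ⁻¹‖y‖` from the flat coercivity
  have hGV : ∀ y : SiteL2K ℂ d (fineP L m) c₀ W,
      ‖GpOfU L m φ η (fun _ : Bond d (fineP L m) => (1 : 𝔸ˣ)) a' (c₁ := c₁) hpos₂ y‖ ≤ γ⁻¹ * ‖y‖ := fun y =>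
    norm_greenK_le hγ hc1 hpos₂ y
  -- the `κ^{−1∕2}` road (`B9Eq325RLipschitzSqrt.norm_RofU_sub_RofU_le_sqrt`) at `(U, 1)`
  exact norm_RofU_sub_RofU_le_sqrt L m φ c₀ η U (fun _ : Bond d (fineP L m) => (1 : 𝔸ˣ)) c₁ a' hRS (hRS_one φ) hpos₁ hpos₂
    hκ₀ hθG0 hMQ0 hθQ0 (by positivity) hκ1 hG hqU hdq hGV hwin f


end Letters

/-! ## §2 The α-linear form: `δ_A∕(s − δ_A) + δ_A∕s ≤ 3δ_A∕s` on `2δ_A ≤ s` -/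

section Linear

/-- the anchored∕linear shape of the two-sided bound: for `0 < s`, `0 ≤ δ`, `2δ ≤ s`: `δ∕(s − δ) + δ∕s ≤ 3δ∕s` (t4-ne9-idea-1 g88's anchored form;
the role of ne9-leaf-06's `CR_le_linear`). [folklore] [cite: Balaban1985BackgroundPropagators, p.403] -/
theorem div_sub_add_div_le_three (s δ : ℝ) (hs : 0 < s) (hδ : 0 ≤ δ) (h2 : 2 * δ ≤ s) : δ / (s - δ) + δ / s ≤ 3 * δ / s := by
  have hsd : 0 < s - δ := by linarith
  have h1 : δ / (s - δ) ≤ 2 * δ / s := by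
    rw [div_le_div_iff₀ hsd hs]; nlinarith
  have e : 3 * δ / s = 2 * δ / s + δ / s := by ring
  rw [e]; exact add_le_add h1 le_rfl

end Linear

/-! ## §3 The diagonal `ηL = 1`, `c₀L^d = c₁`, `εR = K·α·η`: the FORM-slot variant (`κ₀` a letter), the SHARP floor `√κ₀ = (12d(6∕5)^{d−1} + a′)⁻¹`, and the α-linear forms -/

section Diagonal

variable {d : ℕ} (L : ℕ) [NeZero L] (m : Fin d → ℕ) [∀ i, NeZero (fineP L m i)]
  {𝔸 : Type*} [Ring 𝔸] [Algebra ℂ 𝔸]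
  {W : Type*} [NormedAddCommGroup W] [InnerProductSpace ℂ W] [FiniteDimensional ℂ W] (φ : W ≃ₗ[ℂ] 𝔸)
  (c₀ : ℝ) [Fact (0 < c₀)] (η : ℝ) (c₁ : ℝ) [Fact (0 < c₁)] {a' : ℝ} (ha' : 0 < a')
  (U : Bond d (fineP L m) → 𝔸ˣ)
  (hRS : ∀ (b : Bond d (fineP L m)) (v u : W), ⟪adTransportW φ U b v, u⟫_ℂ = ⟪v, adTransportW φ (fun b => (U b)⁻¹) b u⟫_ℂ)
  {K α : ℝ} (hK : 0 ≤ K) (hα : 0 ≤ α) (hRε : ∀ (b : Bond d (fineP L m)) (w : W), ‖adTransportW φ U b w - w‖ ≤ K * α * η * ‖w‖)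

include ha' hRS hK hα hRε

omit [∀ i, NeZero (fineP L m i)] in
/-- **THE `κ^{−1∕2}` CLOSURE ON BAŁABAN's DIAGONAL, `κ₀` A FORM-SLOT LETTER**: at `ηL = 1`, `c₀L^d = c₁`, transporters `Kαη`-close to `1`, `0 < a′`,
with `γ = 1∕(2+2∕a′) − (√d·Kα + (√d·Kα)² + a′(e^{dKα} − 1)(2 + (e^{dKα} − 1)))`, `M_Q = e^{dKα}`, `θ_Q = e^{dKα} − 1`,
`θ_G = 2√d·Kα·γ⁻¹(√γ)⁻¹ + |a′|θ_Q(M_Q + M_Q)γ⁻²` (ne9-leaf-06's diagonal letters) and ANY flat minorant `κ₀ > 0` IN FORM (`hκ1`, so that a Bloch-exact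
`κ(1)` drops in without a new version — ne9-leaf-06 g64's located ask W-3): in the window `0 < γ`, `θ_GM_Q + γ⁻¹θ_Q < √κ₀`,
`‖R(U)f − R(1)f‖ ≤ ((θ_GM_Q + γ⁻¹θ_Q)∕(√κ₀ − (θ_GM_Q + γ⁻¹θ_Q)) + (θ_GM_Q + γ⁻¹θ_Q)∕√κ₀)·‖f‖`. [cite: Balaban1985BackgroundPropagators, p.403, (3.25) p.394, (3.35) p.396, (3.63)–(3.68) pp.402–403, Thm 3.11 p.416] -/
theorem norm_RofU_sub_RofU_one_le_sqrt_diagonal_of_slot (hηL : η * L = 1) (hw : c₀ * (L : ℝ) ^ d = c₁) {κ₀ γ MQ θQ θG : ℝ} (hκ₀ : 0 < κ₀)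
    (hκ1 : ∀ (hη : η ≠ 0) (ψ : SiteL2K ℂ d m c₁ W), κ₀ * ‖ψ‖ ^ 2 ≤ RCLike.re ⟪ψ,
      (((WL2.linearEquiv ℂ ℂ (fun _ : TSite d m => c₁)).symm.toLinearMap ∘ₗ
          QprimeW L m φ (fun _ : Bond d (fineP L m) => (1 : 𝔸ˣ)) (c₀ := c₀)) ∘ₗ
        GpOfU L m φ η (fun _ : Bond d (fineP L m) => (1 : 𝔸ˣ)) a' (c₁ := c₁) (laplacePrimeA_one_pos L m φ η a' hη ha') ∘ₗ
        GpOfU L m φ η (fun _ : Bond d (fineP L m) => (1 : 𝔸ˣ)) a' (c₁ := c₁) (laplacePrimeA_one_pos L m φ η a' hη ha') ∘ₗ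
        LinearMap.adjoint ((WL2.linearEquiv ℂ ℂ (fun _ : TSite d m => c₁)).symm.toLinearMap ∘ₗ
          QprimeW L m φ (fun _ : Bond d (fineP L m) => (1 : 𝔸ˣ)) (c₀ := c₀))) ψ⟫_ℂ)
    (hγdef : γ = 1 / (2 + 2 / a') - (Real.sqrt d * (K * α) + (Real.sqrt d * (K * α)) ^ 2 +
      a' * (Real.exp (d * K * α) - 1) * (2 + (Real.exp (d * K * α) - 1))))
    (hMQdef : MQ = Real.exp (d * K * α)) (hθQdef : θQ = Real.exp (d * K * α) - 1)
    (hθGdef : θG = 2 * (Real.sqrt d * (K * α)) * (γ⁻¹ * (Real.sqrt γ)⁻¹) + (|a'| * θQ * (MQ + MQ)) * γ⁻¹ ^ 2)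
    (hγ : 0 < γ) (hwin : θG * MQ + γ⁻¹ * θQ < Real.sqrt κ₀)
    (f : SiteL2K ℂ d (fineP L m) c₀ W) :
    ‖RofU L m φ η U (c₀ := c₀) f - RofU L m φ η (fun _ : Bond d (fineP L m) => (1 : 𝔸ˣ)) (c₀ := c₀) f‖ ≤
      ((θG * MQ + γ⁻¹ * θQ) / (Real.sqrt κ₀ - (θG * MQ + γ⁻¹ * θQ)) + (θG * MQ + γ⁻¹ * θQ) / Real.sqrt κ₀) * ‖f‖ := by
  have hc₁ : 0 < c₁ := Fact.out
  have hLr : (0 : ℝ) < L := by exact_mod_cast Nat.pos_of_ne_zero (NeZero.ne L)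
  have hηL0 : 0 < η * L := by rw [hηL]; exact one_pos
  have hη0 : 0 < η := pos_of_mul_pos_left hηL0 hLr.le
  have hs : c₁ * (η * L) ^ 2 = c₀ * (L : ℝ) ^ d := by rw [hηL, one_pow, mul_one, hw]
  have hone : (η * L)⁻¹ = 1 := by rw [hηL, inv_one]
  -- the primitive letters on the diagonal
  have ht : ‖((η : ℂ))⁻¹‖ * (K * α * η) ≤ K * α := by
    rw [norm_inv, Complex.norm_real, Real.norm_eq_abs, abs_of_pos hη0]
    rw [show η⁻¹ * (K * α * η) = K * α * (η⁻¹ * η) by ring, inv_mul_cancel₀ hη0.ne', mul_one]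
  have hρ := rho_le_exp_sub_one (d := d) hK hα hηL
  refine norm_RofU_sub_RofU_one_le_sqrt_of_letters L m φ c₀ η c₁ ha' U hRS (by positivity : 0 ≤ K * α * η) hRε hη0.ne' hηL0
    (le_of_eq hηL) hs hκ₀ ht hρ (hκ1 hη0.ne') ?_ ?_ ?_ hθGdef hγ hwin f
  · rw [hγdef, hone]; ring
  · rw [hMQdef, hone]; ring
  · rw [hθQdef, hone, mul_one]

/-- **THE `κ^{−1∕2}` CLOSURE ON BAŁABAN's DIAGONAL WITH THE SHARP FLAT FLOOR** `s♯ = (12d(6∕5)^{d−1} + a′)⁻¹ = √κ₀` of NE9 leaf-01's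
`qggq_coercive_sharp_one_diagonal` (the slot variant fed by it): in the window `0 < γ`, `θ_GM_Q + γ⁻¹θ_Q < s♯`:
`‖R(U)f − R(1)f‖ ≤ ((θ_GM_Q + γ⁻¹θ_Q)∕(s♯ − (θ_GM_Q + γ⁻¹θ_Q)) + (θ_GM_Q + γ⁻¹θ_Q)∕s♯)·‖f‖` — every letter a function of `(d, a′, K, α)`, NO `3 ≤ L`,
NO `κ⁻²`. [cite: Balaban1985BackgroundPropagators, p.403, (3.25) p.394, (3.35) p.396, (3.63)–(3.68) pp.402–403, Thm 3.11 p.416] -/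
theorem norm_RofU_sub_RofU_one_le_sqrt_diagonal (hηL : η * L = 1) (hw : c₀ * (L : ℝ) ^ d = c₁) {γ MQ θQ θG : ℝ}
    (hγdef : γ = 1 / (2 + 2 / a') - (Real.sqrt d * (K * α) + (Real.sqrt d * (K * α)) ^ 2 +
      a' * (Real.exp (d * K * α) - 1) * (2 + (Real.exp (d * K * α) - 1))))
    (hMQdef : MQ = Real.exp (d * K * α)) (hθQdef : θQ = Real.exp (d * K * α) - 1)
    (hθGdef : θG = 2 * (Real.sqrt d * (K * α)) * (γ⁻¹ * (Real.sqrt γ)⁻¹) + (|a'| * θQ * (MQ + MQ)) * γ⁻¹ ^ 2)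
    (hγ : 0 < γ) (hwin : θG * MQ + γ⁻¹ * θQ < 1 / (12 * (d : ℝ) * (6 / 5) ^ (d - 1) + a'))
    (f : SiteL2K ℂ d (fineP L m) c₀ W) :
    ‖RofU L m φ η U (c₀ := c₀) f - RofU L m φ η (fun _ : Bond d (fineP L m) => (1 : 𝔸ˣ)) (c₀ := c₀) f‖ ≤
      ((θG * MQ + γ⁻¹ * θQ) / (1 / (12 * (d : ℝ) * (6 / 5) ^ (d - 1) + a') - (θG * MQ + γ⁻¹ * θQ)) +
        (θG * MQ + γ⁻¹ * θQ) / (1 / (12 * (d : ℝ) * (6 / 5) ^ (d - 1) + a'))) * ‖f‖ := by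
  have hs0 : 0 < 1 / (12 * (d : ℝ) * (6 / 5) ^ (d - 1) + a') := by positivity
  have hsq : Real.sqrt (1 / (12 * (d : ℝ) * (6 / 5) ^ (d - 1) + a') ^ 2) = 1 / (12 * (d : ℝ) * (6 / 5) ^ (d - 1) + a') := by
    rw [← one_div_pow, Real.sqrt_sq hs0.le]
  have hκ₀ : 0 < 1 / (12 * (d : ℝ) * (6 / 5) ^ (d - 1) + a') ^ 2 := by positivity
  have h := norm_RofU_sub_RofU_one_le_sqrt_diagonal_of_slot L m φ c₀ η c₁ ha' U hRS hK hα hRε hηL hw hκ₀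
    (fun hη ψ => qggq_coercive_sharp_one_diagonal L m φ c₀ η c₁ hη hηL hw ha' ψ) hγdef hMQdef hθQdef hθGdef hγ (by rw [hsq]; exact hwin) f
  rw [hsq] at h; exact h

/-- **… IN THE α-LINEAR SHAPE**: on `2(θ_GM_Q + γ⁻¹θ_Q) ≤ s♯`: `‖R(U)f − R(1)f‖ ≤ (3(θ_GM_Q + γ⁻¹θ_Q)∕s♯)·‖f‖`, `s♯ = (12d(6∕5)^{d−1} + a′)⁻¹` — the
`δ_R = C·α` shape the principal-operator assembly consumes once `θ_G, θ_Q` are displayed linear in `α` (ne9-leaf-06's `…ClosedLinear` device).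
[cite: Balaban1985BackgroundPropagators, p.403, (3.25) p.394, (3.35) p.396] -/
theorem norm_RofU_sub_RofU_one_le_sqrt_diagonal_linear (hηL : η * L = 1) (hw : c₀ * (L : ℝ) ^ d = c₁) {γ MQ θQ θG : ℝ}
    (hγdef : γ = 1 / (2 + 2 / a') - (Real.sqrt d * (K * α) + (Real.sqrt d * (K * α)) ^ 2 +
      a' * (Real.exp (d * K * α) - 1) * (2 + (Real.exp (d * K * α) - 1))))
    (hMQdef : MQ = Real.exp (d * K * α)) (hθQdef : θQ = Real.exp (d * K * α) - 1)
    (hθGdef : θG = 2 * (Real.sqrt d * (K * α)) * (γ⁻¹ * (Real.sqrt γ)⁻¹) + (|a'| * θQ * (MQ + MQ)) * γ⁻¹ ^ 2)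
    (hγ : 0 < γ) (hwin2 : 2 * (θG * MQ + γ⁻¹ * θQ) ≤ 1 / (12 * (d : ℝ) * (6 / 5) ^ (d - 1) + a'))
    (f : SiteL2K ℂ d (fineP L m) c₀ W) :
    ‖RofU L m φ η U (c₀ := c₀) f - RofU L m φ η (fun _ : Bond d (fineP L m) => (1 : 𝔸ˣ)) (c₀ := c₀) f‖ ≤
      (3 * (θG * MQ + γ⁻¹ * θQ) / (1 / (12 * (d : ℝ) * (6 / 5) ^ (d - 1) + a'))) * ‖f‖ := by
  have hs0 : 0 < 1 / (12 * (d : ℝ) * (6 / 5) ^ (d - 1) + a') := by positivity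
  -- the letters are nonnegative (as in ne9-leaf-06's closure): `M_Q = e^{…} ≥ 0`, `θ_Q ≥ 0`, `θ_G ≥ 0`
  have hMQ0 : 0 ≤ MQ := by rw [hMQdef]; positivity
  have hθQ0 : 0 ≤ θQ := by rw [hθQdef]; linarith [Real.add_one_le_exp ((d : ℝ) * K * α), show (0 : ℝ) ≤ d * K * α by positivity]
  have hθG0 : 0 ≤ θG := by rw [hθGdef]; positivity
  have hδ0 : 0 ≤ θG * MQ + γ⁻¹ * θQ := by positivity
  have hwin : θG * MQ + γ⁻¹ * θQ < 1 / (12 * (d : ℝ) * (6 / 5) ^ (d - 1) + a') := by linarith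
  exact (norm_RofU_sub_RofU_one_le_sqrt_diagonal L m φ c₀ η c₁ ha' U hRS hK hα hRε hηL hw hγdef hMQdef hθQdef hθGdef hγ hwin f).trans
    (mul_le_mul_of_nonneg_right (div_sub_add_div_le_three _ _ hs0 hδ0 hwin2) (norm_nonneg _))

end Diagonal

end Literature.MathematicalPhysics.QuantumFieldTheory.Balaban1983to89.B9Eq325RLipschitzClosedSqrt

end
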